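import Literature.MathematicalPhysics.QuantumLattice.TorusGibbsBogoliubovRow
import Literature.MathematicalPhysics.QuantumLattice.InfVolFermionStateTorusLimitEnergyEntropyBalance
import HarnessLib

/-!
# Thermal torus-limit states of the `t–t'` Hubbard model satisfy the Bogoliubov rows

Topic `Literature/MathematicalPhysics/QuantumLattice`; the Bogoliubov-row twin of
`InfVolFermionStateTorusLimitEnergyEntropyBalance.lean` (stationarity and linearised
energy–entropy-balance rows of thermal torus limits). The finite-volume states are the canonical GIBBS
states `ρ_{L,β} ∝ P_K e^{−βH_L}` of the `t–t'` Hubbard torus `H_L = hubbardTorusTT' L t t' U` on the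
sector `K = (rectN n L, S^z = 0)` (eigen-mixtures `sectorGibbsWeightTT'`, `sectorGibbsVectorTT'`), and
`ω` is any torus limit of their translation averages along `Ls → ∞`
(`InfVolFermionState.IsTorusLimitOfMixture`). We prove that `ω` satisfies, for every finite region `Λ`,
`Λ₁ = thicken Λ 1`, `H_{Λ₁}` the free-boundary local Hamiltonian of `hubbardTTPrimeFermionInteraction t t' U`,
all local `A, C ∈ 𝔄_Λ` conserving the local particle number and `S^z` (`Ã = ΓA`, `C̃ = ΓC` embedded in
`𝔄_{Λ₁}`) and every `β ≥ 0`, the **Bogoliubov row**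

  `0 ≤ Re ω( ÃÃᴴ + ÃᴴÃ + 2·(C̃Ã − ÃC̃) + (β/2)·(C̃ᴴ(H_{Λ₁}C̃ − C̃H_{Λ₁}) − (H_{Λ₁}C̃ − C̃H_{Λ₁})C̃ᴴ) )`

(`IsTorusLimitOfMixture.re_expect_bog_nonneg_of_sectorGibbs`, and the same row written in any window
`Λ' ⊇ thicken Λ 1`, `…_of_thicken_subset`) — the linear form of Bogoliubov's inequality
`|ω([C̃, Ã])|² ≤ ½β ω({Ã, Ãᴴ}) ω([C̃ᴴ, [H, C̃]])` of a `β`-KMS state (Dyson–Lieb–Simon [DLS1978] (28)),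
here for the gauge-invariant words of a canonical limit. Read over all `Ã`, `C̃` in the span of a
template family this is the positive-semidefiniteness of the Bogoliubov block — an exact KMS constraint
LINEAR in the moments of `ω` (hubbard-thermal THERMAL-SOURCES §2g, row family `bog`). The
finite-volume inequality is `sum_sectorGibbsWeightTT'_mul_re_expect_bog_fockTranslate_nonneg`
(`TorusGibbsBogoliubovRow.lean`) for the sector-preserving torus observables `ΓÃ`, `ΓC̃` in the
translated mixtures `(p_{L,i}, U_v ψ_{L,i})`, averaged over `v` (§1) and passed to the limit (§2).
Everything is PROVED; no definition, no named fact.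

## Mathlib / tree search

REUSED: `sum_sectorGibbsWeightTT'_mul_re_expect_bog_fockTranslate_nonneg` (`TorusGibbsBogoliubovRow`);
`hubbardTorusTT'_commutator_fermionEmbed` (`HubbardNNNHoppingLocalHamiltonian`),
`commute_fermionEmbed_toTorusEmb_totalNumber/spinZ` (`InfVolFermionStateTorusLimitLocalStability`),
`torusAvgExpectAt_of_injOn`, `torusAvgExpect_eq`, `eventually_injOn_proj_of_tendsto`,
`fermionEmbed_fermionEmbed/congr/add/sub/smul/mul/conjTranspose`, `InfVolFermionState.compatible`
(`InfVolFermionState`), `hubbardTTPrime_localHamiltonian_commutator_fermionEmbed_eq`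
(`HubbardTTPrimeWindowCertificateAbstractState`) — exactly the ingredients of the EEB twin.

## References

* [DLS1978] F. J. Dyson, E. H. Lieb, B. Simon, J. Stat. Phys. 18 (1978) 335–383, §2 eq. (28)
  (Bogoliubov's inequality for arbitrary operators). [cite: DLS1978, §2 eq. (28)]
* H. Fawzi, O. Fawzi, S. O. Scalet, Nat. Commun. 15 (2024) 7394 = arXiv:2311.18706, Thm. 3.4 (matrix
  energy–entropy balance, which implies these rows on the same operator span).
  [cite: FawziFawziScalet2024, Thm. 3.4]
-/

noncomputable section

namespace Literature.MathematicalPhysics.QuantumLattice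

open Matrix Finset HubbardWave0 Literature.Probability.LatticeModels ThermodynamicLimit
open _root_.Filter
open scoped _root_.Topology ComplexOrder BigOperators

/-! ### §1 Translation averages of the embedded local Bogoliubov rows on the torus -/

section TorusAverage

variable (L : ℕ) [NeZero L] (t t' U : ℝ)

/-- **The Bogoliubov row of two local words, averaged over the torus translations, is nonnegative in
the canonical Gibbs mixture.** For a region `Λ` with `x ↦ x mod L` injective on
`thicken (thicken Λ 1) 1`, local `A, C ∈ 𝔄_Λ` conserving the local `N` and `S^z`, `Λ₁ = thicken Λ 1`,
`Ã, C̃` their embeddings in `𝔄_{Λ₁}`, `H_{Λ₁}` the free-boundary `t–t'–U` Hamiltonian of `Λ₁` and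
`β ≥ 0`:
`0 ≤ Re Σ_i p_{L,i} · torusAvgExpectAt L Λ₁ (ÃÃᴴ + ÃᴴÃ + 2·(C̃Ã − ÃC̃) + (β/2)·(C̃ᴴ[H_{Λ₁},C̃] − [H_{Λ₁},C̃]C̃ᴴ)) ψ_{L,i}`
(pull-back into the torus: `[H_L, ΓC̃] = Γ[H_{Λ₁}, C̃]`, `hubbardTorusTT'_commutator_fermionEmbed`; `ΓÃ`,
`ΓC̃` conserve the torus `N`, `S^z`; then the translated-mixture inequality for every `v`).
[cite: DLS1978, §2 eq. (28)] -/
theorem re_sum_sectorGibbsWeightTT'_mul_torusAvgExpectAt_bog_nonneg (n : ℝ) {β : ℝ} (hβ : 0 ≤ β)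
    {Λ : Finset (Site 2)} (hInj : Set.InjOn (Torus.proj (d := 2) L) ↑(thicken (thicken Λ 1) 1))
    {A C : FermionOp Λ} (hAN : Commute A totalNumber) (hAS : Commute A HubbardWave0.spinZ)
    (hCN : Commute C totalNumber) (hCS : Commute C HubbardWave0.spinZ) :
    0 ≤ (∑ i, (sectorGibbsWeightTT' β t t' U n L i : ℂ) *
      torusAvgExpectAt L (thicken Λ 1)
        (fermionEmbed (PolySite.incl (subset_thicken Λ 1)) A *
            (fermionEmbed (PolySite.incl (subset_thicken Λ 1)) A)ᴴ +
          (fermionEmbed (PolySite.incl (subset_thicken Λ 1)) A)ᴴ *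
            fermionEmbed (PolySite.incl (subset_thicken Λ 1)) A +
          ((2 : ℝ) : ℂ) • (fermionEmbed (PolySite.incl (subset_thicken Λ 1)) C *
              fermionEmbed (PolySite.incl (subset_thicken Λ 1)) A -
            fermionEmbed (PolySite.incl (subset_thicken Λ 1)) A *
              fermionEmbed (PolySite.incl (subset_thicken Λ 1)) C) +
          ((β / 2 : ℝ) : ℂ) • ((fermionEmbed (PolySite.incl (subset_thicken Λ 1)) C)ᴴ *
              ((hubbardTTPrimeFermionInteraction t t' U).localHamiltonian (thicken Λ 1) *
                  fermionEmbed (PolySite.incl (subset_thicken Λ 1)) C -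
                fermionEmbed (PolySite.incl (subset_thicken Λ 1)) C *
                  (hubbardTTPrimeFermionInteraction t t' U).localHamiltonian (thicken Λ 1)) -
            ((hubbardTTPrimeFermionInteraction t t' U).localHamiltonian (thicken Λ 1) *
                  fermionEmbed (PolySite.incl (subset_thicken Λ 1)) C -
                fermionEmbed (PolySite.incl (subset_thicken Λ 1)) C *
                  (hubbardTTPrimeFermionInteraction t t' U).localHamiltonian (thicken Λ 1)) *
              (fermionEmbed (PolySite.incl (subset_thicken Λ 1)) C)ᴴ))
        (sectorGibbsVectorTT' t t' U n L i)).re := by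
  have h₁ : Set.InjOn (Torus.proj (d := 2) L) ↑(thicken Λ 1) :=
    hInj.mono (by exact_mod_cast subset_thicken (thicken Λ 1) 1)
  have hΛ : Set.InjOn (Torus.proj (d := 2) L) ↑Λ :=
    hInj.mono (by exact_mod_cast (subset_thicken Λ 1).trans (subset_thicken (thicken Λ 1) 1))
  -- the embedded words, as embeddings of `Λ` itself, and their conservation laws on the torus
  set B := fermionEmbed (PolySite.toTorusEmb L hΛ) A with hBdef
  set D := fermionEmbed (PolySite.toTorusEmb L hΛ) C with hDdef
  have hB : fermionEmbed (PolySite.toTorusEmb L h₁) (fermionEmbed (PolySite.incl (subset_thicken Λ 1)) A) = B := by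
    rw [hBdef, fermionEmbed_fermionEmbed]
    exact congrFun (congrArg DFunLike.coe (fermionEmbed_congr fun p => rfl)) A
  have hD : fermionEmbed (PolySite.toTorusEmb L h₁) (fermionEmbed (PolySite.incl (subset_thicken Λ 1)) C) = D := by
    rw [hDdef, fermionEmbed_fermionEmbed]
    exact congrFun (congrArg DFunLike.coe (fermionEmbed_congr fun p => rfl)) C
  have hBN : Commute B totalNumber := commute_fermionEmbed_toTorusEmb_totalNumber L hΛ hAN
  have hBS : Commute B HubbardWave0.spinZ := commute_fermionEmbed_toTorusEmb_spinZ L hΛ hAS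
  have hDN : Commute D totalNumber := commute_fermionEmbed_toTorusEmb_totalNumber L hΛ hCN
  have hDS : Commute D HubbardWave0.spinZ := commute_fermionEmbed_toTorusEmb_spinZ L hΛ hCS
  -- the local commutator pulls back to the torus commutator
  have hK : fermionEmbed (PolySite.toTorusEmb L h₁)
      ((hubbardTTPrimeFermionInteraction t t' U).localHamiltonian (thicken Λ 1) *
          fermionEmbed (PolySite.incl (subset_thicken Λ 1)) C -
        fermionEmbed (PolySite.incl (subset_thicken Λ 1)) C *
          (hubbardTTPrimeFermionInteraction t t' U).localHamiltonian (thicken Λ 1)) =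
      hubbardTorusTT' L t t' U * D - D * hubbardTorusTT' L t t' U := by
    rw [← hubbardTorusTT'_commutator_fermionEmbed L t t' U (subset_thicken Λ 1) subset_rfl hInj C, hD]
  set K := (hubbardTTPrimeFermionInteraction t t' U).localHamiltonian (thicken Λ 1) *
          fermionEmbed (PolySite.incl (subset_thicken Λ 1)) C -
        fermionEmbed (PolySite.incl (subset_thicken Λ 1)) C *
          (hubbardTTPrimeFermionInteraction t t' U).localHamiltonian (thicken Λ 1) with hKdef
  -- pull the row back into the torus
  have hΓ : fermionEmbed (PolySite.toTorusEmb L h₁)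
      (fermionEmbed (PolySite.incl (subset_thicken Λ 1)) A *
            (fermionEmbed (PolySite.incl (subset_thicken Λ 1)) A)ᴴ +
          (fermionEmbed (PolySite.incl (subset_thicken Λ 1)) A)ᴴ *
            fermionEmbed (PolySite.incl (subset_thicken Λ 1)) A +
          ((2 : ℝ) : ℂ) • (fermionEmbed (PolySite.incl (subset_thicken Λ 1)) C *
              fermionEmbed (PolySite.incl (subset_thicken Λ 1)) A -
            fermionEmbed (PolySite.incl (subset_thicken Λ 1)) A *
              fermionEmbed (PolySite.incl (subset_thicken Λ 1)) C) +
          ((β / 2 : ℝ) : ℂ) • ((fermionEmbed (PolySite.incl (subset_thicken Λ 1)) C)ᴴ * K -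
            K * (fermionEmbed (PolySite.incl (subset_thicken Λ 1)) C)ᴴ)) =
      B * Bᴴ + Bᴴ * B + ((2 : ℝ) : ℂ) • (D * B - B * D) +
        ((β / 2 : ℝ) : ℂ) • (Dᴴ * (hubbardTorusTT' L t t' U * D - D * hubbardTorusTT' L t t' U) -
          (hubbardTorusTT' L t t' U * D - D * hubbardTorusTT' L t t' U) * Dᴴ) := by
    simp only [fermionEmbed_add, fermionEmbed_sub, fermionEmbed_smul, fermionEmbed_mul,
      fermionEmbed_conjTranspose, hB, hD, hK]
  -- each translate is nonnegative
  have hv : ∀ v : TorusSite 2 L, 0 ≤ ∑ i, sectorGibbsWeightTT' β t t' U n L i *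
      (expect (B * Bᴴ + Bᴴ * B + ((2 : ℝ) : ℂ) • (D * B - B * D) +
        ((β / 2 : ℝ) : ℂ) • (Dᴴ * (hubbardTorusTT' L t t' U * D - D * hubbardTorusTT' L t t' U) -
          (hubbardTorusTT' L t t' U * D - D * hubbardTorusTT' L t t' U) * Dᴴ))
        ((fockTranslate v).val *ᵥ sectorGibbsVectorTT' t t' U n L i)).re := fun v =>
    sum_sectorGibbsWeightTT'_mul_re_expect_bog_fockTranslate_nonneg L t t' U n hβ v hBN hBS hDN hDS
  -- bookkeeping: real part of the weighted translation average
  have hcast : ((Fintype.card (TorusSite 2 L) : ℂ))⁻¹ = (((Fintype.card (TorusSite 2 L) : ℝ)⁻¹ : ℝ) : ℂ) := by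
    push_cast; rfl
  simp_rw [torusAvgExpectAt_of_injOn L h₁, hΓ]
  rw [Complex.re_sum]
  simp_rw [hcast, ← mul_assoc, ← Complex.ofReal_mul, Complex.re_ofReal_mul, Complex.re_sum, Finset.mul_sum]
  rw [Finset.sum_comm]
  refine Finset.sum_nonneg fun v _ => ?_
  have hfac : ∑ i, sectorGibbsWeightTT' β t t' U n L i * (Fintype.card (TorusSite 2 L) : ℝ)⁻¹ *
      (expect (B * Bᴴ + Bᴴ * B + ((2 : ℝ) : ℂ) • (D * B - B * D) +
        ((β / 2 : ℝ) : ℂ) • (Dᴴ * (hubbardTorusTT' L t t' U * D - D * hubbardTorusTT' L t t' U) -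
          (hubbardTorusTT' L t t' U * D - D * hubbardTorusTT' L t t' U) * Dᴴ))
        ((fockTranslate v).val *ᵥ sectorGibbsVectorTT' t t' U n L i)).re =
      (Fintype.card (TorusSite 2 L) : ℝ)⁻¹ * ∑ i, sectorGibbsWeightTT' β t t' U n L i *
      (expect (B * Bᴴ + Bᴴ * B + ((2 : ℝ) : ℂ) • (D * B - B * D) +
        ((β / 2 : ℝ) : ℂ) • (Dᴴ * (hubbardTorusTT' L t t' U * D - D * hubbardTorusTT' L t t' U) -
          (hubbardTorusTT' L t t' U * D - D * hubbardTorusTT' L t t' U) * Dᴴ))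
        ((fockTranslate v).val *ᵥ sectorGibbsVectorTT' t t' U n L i)).re := by
    rw [Finset.mul_sum]
    exact Finset.sum_congr rfl fun i _ => by ring
  rw [hfac]
  exact mul_nonneg (inv_nonneg.2 (Nat.cast_nonneg _)) (hv v)

end TorusAverage

/-! ### §2 The Bogoliubov rows of thermal torus-limit states -/

namespace InfVolFermionState

/-- **Bogoliubov rows of thermal torus limits.** Let `ω` be a torus limit of the canonical Gibbs states
of `hubbardTorusTT' (Ls j) t t' U` at inverse temperature `β ≥ 0` on the sectors
`(rectN n (Ls j), S^z = 0)` along `Ls → ∞`. Then for every region `Λ`, all local `A, C ∈ 𝔄_Λ`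
conserving the local particle number and `S^z` (`Λ₁ = thicken Λ 1`, `Ã = Γ_{Λ⊆Λ₁}A`, `C̃ = Γ_{Λ⊆Λ₁}C`):
`0 ≤ Re ω_{Λ₁}( ÃÃᴴ + ÃᴴÃ + 2·(C̃Ã − ÃC̃) + (β/2)·(C̃ᴴ(H^{tt'}_{Λ₁}C̃ − C̃H^{tt'}_{Λ₁}) − (H^{tt'}_{Λ₁}C̃ − C̃H^{tt'}_{Λ₁})C̃ᴴ) )`
— the linear form of Bogoliubov's inequality `|ω([C̃,Ã])|² ≤ ½β ω(ÃÃ⋆ + Ã⋆Ã) ω([C̃⋆,[H_{Λ₁},C̃]])` of a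
`β`-KMS state, here for the gauge-invariant words of a canonical limit. [cite: DLS1978, §2 eq. (28)] -/
theorem IsTorusLimitOfMixture.re_expect_bog_nonneg_of_sectorGibbs
    (t t' U : ℝ) {n : ℝ} {β : ℝ} (hβ : 0 ≤ β) {ω : InfVolFermionState 2} {Ls : ℕ → ℕ}
    (h : ω.IsTorusLimitOfMixture (sectorGibbsCount n) (fun L => sectorGibbsWeightTT' β t t' U n L)
      (fun L => sectorGibbsVectorTT' t t' U n L) Ls)
    (hLs : Tendsto Ls atTop atTop) {Λ : Finset (Site 2)} {A C : FermionOp Λ}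
    (hAN : Commute A totalNumber) (hAS : Commute A HubbardWave0.spinZ)
    (hCN : Commute C totalNumber) (hCS : Commute C HubbardWave0.spinZ) :
    0 ≤ (ω.expect (thicken Λ 1)
      (fermionEmbed (PolySite.incl (subset_thicken Λ 1)) A *
            (fermionEmbed (PolySite.incl (subset_thicken Λ 1)) A)ᴴ +
          (fermionEmbed (PolySite.incl (subset_thicken Λ 1)) A)ᴴ *
            fermionEmbed (PolySite.incl (subset_thicken Λ 1)) A +
          ((2 : ℝ) : ℂ) • (fermionEmbed (PolySite.incl (subset_thicken Λ 1)) C *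
              fermionEmbed (PolySite.incl (subset_thicken Λ 1)) A -
            fermionEmbed (PolySite.incl (subset_thicken Λ 1)) A *
              fermionEmbed (PolySite.incl (subset_thicken Λ 1)) C) +
          ((β / 2 : ℝ) : ℂ) • ((fermionEmbed (PolySite.incl (subset_thicken Λ 1)) C)ᴴ *
              ((hubbardTTPrimeFermionInteraction t t' U).localHamiltonian (thicken Λ 1) *
                  fermionEmbed (PolySite.incl (subset_thicken Λ 1)) C -
                fermionEmbed (PolySite.incl (subset_thicken Λ 1)) C *
                  (hubbardTTPrimeFermionInteraction t t' U).localHamiltonian (thicken Λ 1)) -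
            ((hubbardTTPrimeFermionInteraction t t' U).localHamiltonian (thicken Λ 1) *
                  fermionEmbed (PolySite.incl (subset_thicken Λ 1)) C -
                fermionEmbed (PolySite.incl (subset_thicken Λ 1)) C *
                  (hubbardTTPrimeFermionInteraction t t' U).localHamiltonian (thicken Λ 1)) *
              (fermionEmbed (PolySite.incl (subset_thicken Λ 1)) C)ᴴ))).re := by
  refine ge_of_tendsto ((Complex.continuous_re.tendsto _).comp (h (thicken Λ 1) _)) ?_
  filter_upwards [eventually_injOn_proj_of_tendsto (thicken (thicken Λ 1) 1) hLs, hLs.eventually_ge_atTop 1]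
    with j hInj hj
  haveI : NeZero (Ls j) := ⟨by omega⟩
  rw [Function.comp_apply]
  simp_rw [torusAvgExpect_eq]
  exact re_sum_sectorGibbsWeightTT'_mul_torusAvgExpectAt_bog_nonneg (Ls j) t t' U n hβ hInj hAN hAS hCN hCS

/-- **The Bogoliubov rows in an arbitrary window.** Under the hypotheses of
`re_expect_bog_nonneg_of_sectorGibbs`, for every window `Λ' ⊇ thicken Λ 1` (`Λ ⊆ Λ'`) the same row
written with the local Hamiltonian of `Λ'` and `Γ = Γ_{Λ⊆Λ'}` holds:
`0 ≤ Re ω_{Λ'}( ΓA(ΓA)ᴴ + (ΓA)ᴴΓA + 2·(ΓC ΓA − ΓA ΓC) + (β/2)·((ΓC)ᴴ[H^{tt'}_{Λ'}, ΓC] − [H^{tt'}_{Λ'}, ΓC](ΓC)ᴴ) )`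
— the terms of `H_{Λ'}` outside `thicken Λ 1` commute with `ΓC`
(`hubbardTTPrime_localHamiltonian_commutator_fermionEmbed_eq`) and `ω` is compatible with the inclusions.
This is the shape in which a window certificate carries the `bog` rows. [cite: DLS1978, §2 eq. (28)] -/
theorem IsTorusLimitOfMixture.re_expect_bog_nonneg_of_sectorGibbs_of_thicken_subset
    (t t' U : ℝ) {n : ℝ} {β : ℝ} (hβ : 0 ≤ β) {ω : InfVolFermionState 2} {Ls : ℕ → ℕ}
    (h : ω.IsTorusLimitOfMixture (sectorGibbsCount n) (fun L => sectorGibbsWeightTT' β t t' U n L)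
      (fun L => sectorGibbsVectorTT' t t' U n L) Ls)
    (hLs : Tendsto Ls atTop atTop) {Λ Λ' : Finset (Site 2)} (hΛ : Λ ⊆ Λ') (h8 : thicken Λ 1 ⊆ Λ')
    {A C : FermionOp Λ} (hAN : Commute A totalNumber) (hAS : Commute A HubbardWave0.spinZ)
    (hCN : Commute C totalNumber) (hCS : Commute C HubbardWave0.spinZ) :
    0 ≤ (ω.expect Λ'
      (fermionEmbed (PolySite.incl hΛ) A * (fermionEmbed (PolySite.incl hΛ) A)ᴴ +
          (fermionEmbed (PolySite.incl hΛ) A)ᴴ * fermionEmbed (PolySite.incl hΛ) A +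
          ((2 : ℝ) : ℂ) • (fermionEmbed (PolySite.incl hΛ) C * fermionEmbed (PolySite.incl hΛ) A -
            fermionEmbed (PolySite.incl hΛ) A * fermionEmbed (PolySite.incl hΛ) C) +
          ((β / 2 : ℝ) : ℂ) • ((fermionEmbed (PolySite.incl hΛ) C)ᴴ *
              ((hubbardTTPrimeFermionInteraction t t' U).localHamiltonian Λ' * fermionEmbed (PolySite.incl hΛ) C -
                fermionEmbed (PolySite.incl hΛ) C * (hubbardTTPrimeFermionInteraction t t' U).localHamiltonian Λ') -
            ((hubbardTTPrimeFermionInteraction t t' U).localHamiltonian Λ' * fermionEmbed (PolySite.incl hΛ) C -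
                fermionEmbed (PolySite.incl hΛ) C * (hubbardTTPrimeFermionInteraction t t' U).localHamiltonian Λ') *
              (fermionEmbed (PolySite.incl hΛ) C)ᴴ))).re := by
  have hA : fermionEmbed (PolySite.incl hΛ) A =
      fermionEmbed (PolySite.incl h8) (fermionEmbed (PolySite.incl (subset_thicken Λ 1)) A) := by
    rw [fermionEmbed_fermionEmbed, PolySite.incl_trans]
  have hC : fermionEmbed (PolySite.incl hΛ) C =
      fermionEmbed (PolySite.incl h8) (fermionEmbed (PolySite.incl (subset_thicken Λ 1)) C) := by
    rw [fermionEmbed_fermionEmbed, PolySite.incl_trans]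
  rw [hubbardTTPrime_localHamiltonian_commutator_fermionEmbed_eq t t' U hΛ h8 C]
  set K := (hubbardTTPrimeFermionInteraction t t' U).localHamiltonian (thicken Λ 1) *
          fermionEmbed (PolySite.incl (subset_thicken Λ 1)) C -
        fermionEmbed (PolySite.incl (subset_thicken Λ 1)) C *
          (hubbardTTPrimeFermionInteraction t t' U).localHamiltonian (thicken Λ 1) with hKdef
  rw [hA, hC]
  have hG : fermionEmbed (PolySite.incl h8) (fermionEmbed (PolySite.incl (subset_thicken Λ 1)) A) *
          (fermionEmbed (PolySite.incl h8) (fermionEmbed (PolySite.incl (subset_thicken Λ 1)) A))ᴴ +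
        (fermionEmbed (PolySite.incl h8) (fermionEmbed (PolySite.incl (subset_thicken Λ 1)) A))ᴴ *
          fermionEmbed (PolySite.incl h8) (fermionEmbed (PolySite.incl (subset_thicken Λ 1)) A) +
        ((2 : ℝ) : ℂ) • (fermionEmbed (PolySite.incl h8) (fermionEmbed (PolySite.incl (subset_thicken Λ 1)) C) *
            fermionEmbed (PolySite.incl h8) (fermionEmbed (PolySite.incl (subset_thicken Λ 1)) A) -
          fermionEmbed (PolySite.incl h8) (fermionEmbed (PolySite.incl (subset_thicken Λ 1)) A) *
            fermionEmbed (PolySite.incl h8) (fermionEmbed (PolySite.incl (subset_thicken Λ 1)) C)) +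
        ((β / 2 : ℝ) : ℂ) • ((fermionEmbed (PolySite.incl h8) (fermionEmbed (PolySite.incl (subset_thicken Λ 1)) C))ᴴ *
            fermionEmbed (PolySite.incl h8) K -
          fermionEmbed (PolySite.incl h8) K *
            (fermionEmbed (PolySite.incl h8) (fermionEmbed (PolySite.incl (subset_thicken Λ 1)) C))ᴴ) =
      fermionEmbed (PolySite.incl h8)
        (fermionEmbed (PolySite.incl (subset_thicken Λ 1)) A *
            (fermionEmbed (PolySite.incl (subset_thicken Λ 1)) A)ᴴ +
          (fermionEmbed (PolySite.incl (subset_thicken Λ 1)) A)ᴴ *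
            fermionEmbed (PolySite.incl (subset_thicken Λ 1)) A +
          ((2 : ℝ) : ℂ) • (fermionEmbed (PolySite.incl (subset_thicken Λ 1)) C *
              fermionEmbed (PolySite.incl (subset_thicken Λ 1)) A -
            fermionEmbed (PolySite.incl (subset_thicken Λ 1)) A *
              fermionEmbed (PolySite.incl (subset_thicken Λ 1)) C) +
          ((β / 2 : ℝ) : ℂ) • ((fermionEmbed (PolySite.incl (subset_thicken Λ 1)) C)ᴴ * K -
            K * (fermionEmbed (PolySite.incl (subset_thicken Λ 1)) C)ᴴ)) := by
    simp only [fermionEmbed_add, fermionEmbed_sub, fermionEmbed_smul, fermionEmbed_mul,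
      fermionEmbed_conjTranspose]
  rw [hG, ω.compatible h8]
  exact h.re_expect_bog_nonneg_of_sectorGibbs t t' U hβ hLs hAN hAS hCN hCS

end InfVolFermionState

end Literature.MathematicalPhysics.QuantumLattice

end
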